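import Mathlib
import HarnessLib
import Literature.Analysis.FluidPDE.FlatSwirlGaugeRelabel
import Summits.NavierStokesRegularity.NavierStokesRegularity.Theorems.PoloidalWindowDoorPoloidalWindowRigidityTimeShearPressure
import Summits.NavierStokesRegularity.NavierStokesRegularity.Theorems.PoloidalWindowDoorPoloidalWindowRigidityMaterialLeibniz
import Summits.NavierStokesRegularity.NavierStokesRegularity.Theorems.PoloidalWindowDoorPoloidalWindowRigiditySlopeLaw
import Summits.NavierStokesRegularity.NavierStokesRegularity.Theorems.PoloidalWindowDoorPoloidalWindowRigidityVerticalSourceGauge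

/-!
# Route `PoloidalWindowDoor`, crux `PoloidalWindowRigidity` (K2, stmt-NavierStokesRegularity-19708) — the stratum (SF)
# «SHEAR SLOPE A FUNCTION OF TIME AND VERTICAL VELOCITY», I: its PRESSURE LAW and Clebsch weight

Cell ns-regularity-ideate, seat ns-poloidal-K2-p2 gen 4 (stub-worker on crux K2; file landed
`--supports stmt-NavierStokesRegularity-19708` as a helper).  WHAT THIS IS NOT: not a claim about Navier–Stokes regularity,
not the registered stub `stub_lrcModEntire` — structure theorems for one located stratum of the crux's generic residue
(bears_on LADDER-NS N0 via crux K2 = stmt-19708).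

THE STRATUM (SF).  For a poloidal profile (`ω₂ ≡ 0`) the shear `∂₂v_h` and the horizontal gradient `∇_h v₂` are parallel
(frozen constraint), `∂₂v_b = μ ∂_b v₂`; locally the slope `μ` is always a function of `(t, x₂, v₂)` (it is `h_{θθ}` for the
Bernoulli head `h(t,x₂,θ)` as a function of the vertical velocity `θ = v₂`).  (SF) is the stratum on which the slope has NO
explicit height dependence: **`∂₂v_b(t,y) = m(t, v₂(t,y)) ∂_b v₂(t,y)`** (`b = 0,1`) for one function `m : ℝ → ℝ → ℝ`,
equivalently `∂₂v_h = ∇_h[G(t,v₂)]` with `∂_sG = m`.  It contains (TV) («time-dependent proportional shear», `m = μ(t)`,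
closed in the tree: p525351 ∨ p519353) and refuter1's K-a; it is transverse to the lead's (TH) (`μ = μ(t,x₂)`).

* `material_regauge` — calculus: for a scalar `θ` and `G ∈ C²(ℝ²)`, with `𝓛 = ∂ₜ + V·∇ − Δ` at `(t,x)`:
  `𝓛[G(·,θ)] = (∂ₜG)(t,θ) + (∂_sG)(t,θ)·𝓛θ − (∂_s²G)(t,θ)·‖∇θ‖²` (Literature re-gauge calculus `deriv_regauge_time`,
  `laplacian_comp_deriv_of_contDiffAt`).
* `slopeFunction_pressure` — **THE PRESSURE LAW OF (SF)** (generalises ns-poloidal-K2-p3's `timeShear_pressure_weighted`,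
  `m = μ(t)`): class + poloidal + (SF) with `m ∈ C²(ℝ²)` ⇒ at every point of every slice, for the intrinsic residual
  `f = ∂ₜv + (v·∇)v − Δv` (`= −∇p`) and `b = 0,1`:
  **`(1 − m)(∂_b f)₂ = ∂_bv₂·(m_t + m_s f₂ − m_ss‖∇v₂‖²) − 2 m_s Σᵢ ∂ᵢv₂ ∂ᵢ∂_b v₂`**, all of `m, m_t, m_s, m_ss` evaluated at
  `(t, v₂(t,x))`.  Proof = p517107's: apply `𝓛` to the constraint `∂₂v_b = m(t,v₂)∂_bv₂` (velocity-gradient law for both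
  sides, Leibniz rule `material_mul`, the re-gauge calculus for `𝓛[m(t,v₂)]`, the vertical momentum equation `𝓛v₂ = f₂`);
  the quadratic terms `Σⱼ∂₂vⱼ∂ⱼv_b − mΣⱼ∂_bvⱼ∂ⱼv₂` cancel by `∂₂v_a = m∂_av₂` and `∂₀v₁ = ∂₁v₀`; `curl f = 0` turns
  `(∂₂f)_b` into `(∂_bf)₂`.
* `material_clebschWeight` — for the CLEBSCH WEIGHT `u := v₂ − G(t,v₂)` (any `G ∈ C²(ℝ²)`; on (SF) take `∂_sG = m`):
  `𝓛u = (1 − ∂_sG)f₂ − ∂ₜG + ∂_s²G·Σᵢ(∂ᵢv₂)²`; `hasFDerivAt_clebschWeight` (`∇u = (1 − ∂_sG)∇v₂`) and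
  `curl_eq_of_slopeFunction` (on (SF), `ω_h = J∇_h u`: `ω₀ = (1−∂_sG)∂₁v₂`, `ω₁ = −(1−∂_sG)∂₀v₂`, `ω₂ = 0`).

SEQUELS: `…SlopeFunctionSource` — by this pressure law (with `m = ∂_sG`, Clairaut) `∇_h 𝓛u = 0`: **on (SF) the Clebsch
weight is a passive scalar driven by a source `a(t,x₂)` depending on time and height only**; `…SlopeFunctionPassive` — the
sub-stratum where that source is height-free is EMPTY in the class (ancient decaying-slope Liouville lemma ⇒ `u`
slice-constant ⇒ `curl v ≡ 0` ⇒ `v ≡ 0`); the height dependence of `a` is the located residual of (SF) (production term of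
the horizontal-variance law of `u`; seat note SF-NEXT.md on the crux item).
-/

noncomputable section

-- the summit and its single sub-problem share the name (CONVENTIONS §1), as in every Theorems file
set_option linter.dupNamespace false

namespace Summit.NavierStokesRegularity.NavierStokesRegularity.Theorems.PoloidalWindowDoorPoloidalWindowRigiditySlopeFunctionPressure

open MeasureTheory Set Function Filter Topology TopologicalSpace Metric InnerProductSpace
open scoped RealInnerProductSpace InnerProductSpace Laplacian ContDiff
open Literature.Analysis Literature.Analysis.FluidPDE
open Summit.NavierStokesRegularity.NavierStokesRegularity.Theorems.LocalSineTubeDoorProfileAlignedWindowRigidityAncient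
open Summit.NavierStokesRegularity.NavierStokesRegularity.Theorems.PoloidalWindowDoorPoloidalWindowRigidityWindow
open Summit.NavierStokesRegularity.NavierStokesRegularity.Theorems.PoloidalWindowDoorPoloidalWindowRigidityFlat
open Summit.NavierStokesRegularity.NavierStokesRegularity.Theorems.PoloidalWindowDoorPoloidalWindowRigidityVelocityGradientLaw
open Summit.NavierStokesRegularity.NavierStokesRegularity.Theorems.PoloidalWindowDoorPoloidalWindowRigiditySeparatedPressure
open Summit.NavierStokesRegularity.NavierStokesRegularity.Theorems.PoloidalWindowDoorPoloidalWindowRigidityMaterialLeibniz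
open Summit.NavierStokesRegularity.NavierStokesRegularity.Theorems.PoloidalWindowDoorPoloidalWindowRigidityVerticalSourceGauge
open Summit.NavierStokesRegularity.NavierStokesRegularity.Theorems.PoloidalWindowDoorPoloidalWindowRigiditySlopeLaw

variable {C : ℝ} {v : ℝ → EuclideanSpace ℝ (Fin 3) → EuclideanSpace ℝ (Fin 3)}

/-! ### Calculus: the gradient norm in coordinates, and the material derivative of a re-gauged scalar -/

/-- `‖∇g(x)‖² = Σᵢ (∂ᵢ g)²` in the standard coordinates of `ℝ³`. -/
theorem norm_gradient_sq_eq_sum (g : EuclideanSpace ℝ (Fin 3) → ℝ) (x : EuclideanSpace ℝ (Fin 3)) :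
    ‖gradient g x‖ ^ 2 = ∑ i : Fin 3, fderiv ℝ g x (EuclideanSpace.single i 1) ^ 2 := by
  rw [EuclideanSpace.norm_sq_eq]
  refine Finset.sum_congr rfl fun i _ => ?_
  have h : gradient g x i = fderiv ℝ g x (EuclideanSpace.single i 1) := by
    rw [← inner_gradient_left, EuclideanSpace.inner_single_right]
    simp
  rw [Real.norm_eq_abs, sq_abs, h]

/-- **Material derivative of a re-gauged scalar.**  For `θ : ℝ → ℝ³ → ℝ` differentiable in time at `(t,x)` with a `C²`
slice at `t`, `G : ℝ → ℝ → ℝ` jointly `C²`, and any vector `V`, with `𝓛φ := deriv (φ · x) t + D(φ t)(x)[V] − Δ(φ t)(x)`: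
`𝓛[G(·, θ)] = (∂ₜG)(t,θ(t,x)) + (∂_sG)(t,θ(t,x))·𝓛θ − (∂_s²G)(t,θ(t,x))·Σᵢ(∂ᵢθ)²`. -/
theorem material_regauge {θ : ℝ → EuclideanSpace ℝ (Fin 3) → ℝ} {G : ℝ → ℝ → ℝ} {t : ℝ}
    {x : EuclideanSpace ℝ (Fin 3)} (V : EuclideanSpace ℝ (Fin 3)) (hG : ContDiff ℝ 2 (uncurry G))
    (hθt : DifferentiableAt ℝ (fun s => θ s x) t) (hθx : ContDiff ℝ 2 (θ t)) :
    deriv (fun s => G s (θ s x)) t + fderiv ℝ (fun y => G t (θ t y)) x V - Δ (fun y => G t (θ t y)) x =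
      deriv (fun s => G s (θ t x)) t
        + deriv (G t) (θ t x) * (deriv (fun s => θ s x) t + fderiv ℝ (θ t) x V - Δ (θ t) x)
        - deriv (deriv (G t)) (θ t x) * ∑ i : Fin 3, fderiv ℝ (θ t) x (EuclideanSpace.single i 1) ^ 2 := by
  have hGt : ContDiff ℝ 2 (G t) := hG.comp (contDiff_const.prodMk contDiff_id)
  have hGd : DifferentiableAt ℝ (uncurry G) (t, θ t x) := (hG.differentiable (by norm_num)) _
  have hθd : DifferentiableAt ℝ (θ t) x := (hθx.differentiable (by norm_num)) x
  -- time
  have h1 : deriv (fun s => G s (θ s x)) t =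
      deriv (fun s => G s (θ t x)) t + deriv (G t) (θ t x) * deriv (fun s => θ s x) t :=
    deriv_regauge_time (Φ := G) (a := fun s => θ s x) hGd hθt
  -- space, first order
  have h2 : fderiv ℝ (fun y => G t (θ t y)) x V = deriv (G t) (θ t x) * fderiv ℝ (θ t) x V := by
    have h := ((hGt.differentiable (by norm_num)) (θ t x)).hasDerivAt.comp_hasFDerivAt x hθd.hasFDerivAt
    rw [show (fun y => G t (θ t y)) = G t ∘ θ t from rfl, h.fderiv]
    simp only [FunLike.coe_smul, Pi.smul_apply, smul_eq_mul]
  -- space, second order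
  have h3 : Δ (fun y => G t (θ t y)) x =
      deriv (deriv (G t)) (θ t x) * ‖gradient (θ t) x‖ ^ 2 + deriv (G t) (θ t x) * Δ (θ t) x :=
    laplacian_comp_deriv_of_contDiffAt hθx.contDiffAt hGt.contDiffAt
  rw [h1, h2, h3, norm_gradient_sq_eq_sum]
  ring

/-! ### Regularity of the atoms along the class -/

section Class

variable (hrate : HasTypeITimeDecay C v) (hcont : ContinuousOn (uncurry v) (Iio (0 : ℝ) ×ˢ univ))
  (hmild : ∀ s t : ℝ, s < t → t < 0 → ∀ x,
    v t x = UnboundedOperators.heatExtension (v s) (t - s) x - oseenDuhamel 1 s v v t x)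
  (hdiv : ∀ t < 0, VectorCalculus.IsDivFree (v t))

include hrate hcont hmild hdiv

/-- The time line `s ↦ v₂(s,x)` of a profile of the class is differentiable at every `t < 0`. -/
theorem differentiableAt_vert_time {t : ℝ} (ht : t < 0) (x : EuclideanSpace ℝ (Fin 3)) :
    DifferentiableAt ℝ (fun s => v s x 2) t := by
  have h1 : DifferentiableAt ℝ (uncurry v) (t, x) :=
    (contDiffAt_uncurry_of_class hrate hcont hmild hdiv ht x 1).differentiableAt (by norm_num)
  have h2 : DifferentiableAt ℝ (uncurry v ∘ fun s : ℝ => (s, x)) t :=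
    h1.comp t (differentiableAt_id.prodMk (differentiableAt_const x))
  have h3 := ((EuclideanSpace.proj (𝕜 := ℝ) (2 : Fin 3) : EuclideanSpace ℝ (Fin 3) →L[ℝ] ℝ).differentiableAt).comp t h2
  simpa [Function.comp_def] using h3

/-- The slice `y ↦ v₂(t,y)` of a profile of the class is `C^∞`. -/
theorem contDiff_vert_slice {t : ℝ} (ht : t < 0) : ContDiff ℝ ∞ (fun y => v t y 2) := by
  have hA : IsTypeIAncientMild C v := isTypeIAncientMild_of_class hrate hcont hmild hdiv
  exact (EuclideanSpace.proj (𝕜 := ℝ) (2 : Fin 3) : EuclideanSpace ℝ (Fin 3) →L[ℝ] ℝ).contDiff.comp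
    (hA.contDiff_slice ht)

/-- **The vertical momentum equation in coordinates**: `𝓛v₂ = f₂` with `f = ∂ₜv + (v·∇)v − Δv` the intrinsic residual. -/
theorem material_vert_eq_residual {t : ℝ} (ht : t < 0) (x : EuclideanSpace ℝ (Fin 3)) :
    deriv (fun s => v s x 2) t + fderiv ℝ (fun y => v t y 2) x (v t x) - Δ (fun y => v t y 2) x =
      (timeDerivWithin (Iio 0) v t x + convect (v t) (v t) x - Δ (v t) x) 2 := by
  have hv := vertical_equation hrate hcont hmild hdiv ht x
  have hfun : (fun y => ⟪v t y, (EuclideanSpace.single 2 (1 : ℝ) : EuclideanSpace ℝ (Fin 3))⟫_ℝ) =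
      fun y => v t y 2 := by
    funext y; simp [EuclideanSpace.inner_single_right]
  have hfun' : (fun τ => ⟪v τ x, (EuclideanSpace.single 2 (1 : ℝ) : EuclideanSpace ℝ (Fin 3))⟫_ℝ) =
      fun τ => v τ x 2 := by
    funext τ; simp [EuclideanSpace.inner_single_right]
  rw [hfun, hfun'] at hv
  rw [hv]
  simp [EuclideanSpace.inner_single_right]

/-! ### The pressure law of the stratum (SF) -/

/-- **THE PRESSURE LAW OF (SF).**  Let `v` be a profile of the route's Type-I class, poloidal along `e₃` on every slice,
on the stratum (SF): `∂₂v_b(s,y) = m(s, v₂(s,y)) ∂_b v₂(s,y)` (`b = 0,1`, all `s < 0`) for a jointly `C²` slope function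
`m : ℝ → ℝ → ℝ`.  Then at every `t < 0`, `x`, for the intrinsic residual `f = ∂ₜv + (v·∇)v − Δv` (`= −∇p`) and `b = 0,1`,
with `θ₀ = v₂(t,x)`, `m_t = ∂ₜm(t,θ₀)`, `m_s = ∂_sm(t,θ₀)`, `m_ss = ∂_s²m(t,θ₀)`:
`(1 − m(t,θ₀))·(∂_b f)₂ = ∂_b v₂·(m_t + m_s f₂ − m_ss Σᵢ(∂ᵢv₂)²) − 2 m_s Σᵢ ∂ᵢv₂ ∂ᵢ(∂_b v₂)`.
(For `m = μ(t)`: `(1−μ)(∂_bf)₂ = μ′∂_bv₂`, ns-poloidal-K2-p3's `timeShear_pressure_weighted`.) -/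
theorem slopeFunction_pressure
    (hpol : ∀ s < 0, ∀ y, ⟪curl (v s) y, EuclideanSpace.single 2 1⟫_ℝ = 0) {m : ℝ → ℝ → ℝ}
    (hm : ContDiff ℝ 2 (uncurry m)) {t : ℝ} (ht : t < 0)
    (hslope : ∀ s < 0, ∀ y, ∀ b : Fin 3, b ≠ 2 →
      fderiv ℝ (v s) y (EuclideanSpace.single 2 1) b = m s (v s y 2) * fderiv ℝ (v s) y (EuclideanSpace.single b 1) 2)
    (x : EuclideanSpace ℝ (Fin 3)) {b : Fin 3} (hb : b ≠ 2) :
    (1 - m t (v t x 2)) * fderiv ℝ (fun y => timeDerivWithin (Iio 0) v t y + convect (v t) (v t) y - Δ (v t) y) x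
          (EuclideanSpace.single b 1) 2 =
      fderiv ℝ (v t) x (EuclideanSpace.single b 1) 2 *
          (deriv (fun τ => m τ (v t x 2)) t
            + deriv (m t) (v t x 2) * (timeDerivWithin (Iio 0) v t x + convect (v t) (v t) x - Δ (v t) x) 2
            - deriv (deriv (m t)) (v t x 2) * ∑ i : Fin 3, fderiv ℝ (v t) x (EuclideanSpace.single i 1) 2 ^ 2)
        - 2 * deriv (m t) (v t x 2) * ∑ i : Fin 3, fderiv ℝ (v t) x (EuclideanSpace.single i 1) 2 *
            fderiv ℝ (fun y => fderiv ℝ (v t) y (EuclideanSpace.single b 1) 2) x (EuclideanSpace.single i 1) := by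
  have hA : IsTypeIAncientMild C v := isTypeIAncientMild_of_class hrate hcont hmild hdiv
  have hs : ContDiff ℝ ∞ (v t) := hA.contDiff_slice ht
  have hsd : Differentiable ℝ (v t) := hs.differentiable (by simp)
  have hb' : b = 0 ∨ b = 1 := by
    fin_cases b <;> simp at hb ⊢
  -- ## the two velocity-gradient laws and `curl f = 0`
  have hL3 := fderiv_equation_coord hrate hcont hmild hdiv ht x (EuclideanSpace.single 2 1) b
  have hLb := fderiv_equation_coord hrate hcont hmild hdiv ht x (EuclideanSpace.single b 1) 2
  rw [apply_apply_coord] at hL3 hLb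
  obtain ⟨hc0, hc1⟩ := fderiv_residual_symm hrate hcont hmild hdiv ht x
  -- ## opaque names for the slope along the profile and for the horizontal gradient entry
  obtain ⟨M, hM⟩ : ∃ M : ℝ → EuclideanSpace ℝ (Fin 3) → ℝ, ∀ s y, M s y = m s (v s y 2) := ⟨_, fun _ _ => rfl⟩
  obtain ⟨g, hg⟩ : ∃ g : ℝ → EuclideanSpace ℝ (Fin 3) → ℝ,
      ∀ s y, g s y = fderiv ℝ (v s) y (EuclideanSpace.single b 1) 2 := ⟨_, fun _ _ => rfl⟩
  have hMfun : ∀ s, M s = fun y => m s (v s y 2) := fun s => funext (hM s)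
  have hgfun : ∀ s, g s = fun y => fderiv ℝ (v s) y (EuclideanSpace.single b 1) 2 := fun s => funext (hg s)
  -- ## regularity of the atoms
  have hθx : ContDiff ℝ ∞ (fun y => v t y 2) := contDiff_vert_slice hrate hcont hmild hdiv ht
  have hθt : DifferentiableAt ℝ (fun s => v s x 2) t := differentiableAt_vert_time hrate hcont hmild hdiv ht x
  have hmt : ContDiff ℝ 2 (m t) := hm.comp (contDiff_const.prodMk contDiff_id)
  have hMx : ContDiff ℝ 2 (M t) := by
    rw [hMfun]; exact hmt.comp (hθx.of_le (by norm_cast))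
  have hMt : DifferentiableAt ℝ (fun s => M s x) t := by
    have h1 : DifferentiableAt ℝ (uncurry m ∘ fun s => (s, v s x 2)) t :=
      ((hm.differentiable (by norm_num)) _).comp t (differentiableAt_id.prodMk hθt)
    have h2 : (fun s => M s x) = uncurry m ∘ fun s => (s, v s x 2) := by
      funext s; simp [hM]
    rw [h2]; exact h1
  have hgx : ContDiff ℝ ∞ (g t) := by
    rw [hgfun]; exact contDiff_fderiv_coord hrate hcont hmild hdiv ht (EuclideanSpace.single b 1) 2
  have hgt : DifferentiableAt ℝ (fun s => g s x) t := by
    have h := differentiableAt_fderiv_slice_coord hrate hcont hmild hdiv ht x (EuclideanSpace.single b 1) 2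
    have h2 : (fun s => g s x) = fun s => fderiv ℝ (v s) x (EuclideanSpace.single b 1) 2 := funext fun s => hg s x
    rw [h2]; exact h
  -- ## the constrained entry `∂₂v_b = M·g` near `t` (in time) and on the slice (in space)
  have hfun_t : (fun s => fderiv ℝ (v s) x (EuclideanSpace.single 2 1) b) =ᶠ[𝓝 t] fun s => M s x * g s x := by
    filter_upwards [Iio_mem_nhds ht] with s hs'
    rw [hM, hg]; exact hslope s hs' x b hb
  have hfun_x : (fun y => fderiv ℝ (v t) y (EuclideanSpace.single 2 1) b) = fun y => M t y * g t y := by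
    funext y; rw [hM, hg]; exact hslope t ht y b hb
  -- ## Leibniz: `𝓛(M g) = M 𝓛g + g 𝓛M − 2 Σᵢ ∂ᵢM ∂ᵢg`
  have hLeib := material_mul (θ₁ := M) (θ₂ := g) (t := t) (x := x) (v t x) hMt hgt hMx (hgx.of_le (by norm_cast))
  -- ## the re-gauge calculus for `𝓛M` and the vertical momentum equation `𝓛v₂ = f₂`
  have hLM : deriv (fun s => M s x) t + fderiv ℝ (M t) x (v t x) - Δ (M t) x =
      deriv (fun τ => m τ (v t x 2)) t
        + deriv (m t) (v t x 2) * (timeDerivWithin (Iio 0) v t x + convect (v t) (v t) x - Δ (v t) x) 2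
        - deriv (deriv (m t)) (v t x 2) * ∑ i : Fin 3, fderiv ℝ (v t) x (EuclideanSpace.single i 1) 2 ^ 2 := by
    have h := material_regauge (θ := fun s y => v s y 2) (G := m) (t := t) (x := x) (v t x) hm hθt
      (hθx.of_le (by norm_cast))
    have e1 : (fun s => M s x) = fun s => m s (v s x 2) := funext fun s => hM s x
    rw [e1, hMfun t, h, material_vert_eq_residual hrate hcont hmild hdiv ht x]
    have e2 : ∀ i : Fin 3, fderiv ℝ (fun y => v t y 2) x (EuclideanSpace.single i 1) =
        fderiv ℝ (v t) x (EuclideanSpace.single i 1) 2 := fun i => FluidPDE.fderiv_apply_coord (hsd x) _ 2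
    simp only [e2]
  -- the horizontal derivatives of `M`: `∂ᵢM = m_s ∂ᵢv₂`
  have hdM : ∀ i : Fin 3, fderiv ℝ (M t) x (EuclideanSpace.single i 1) =
      deriv (m t) (v t x 2) * fderiv ℝ (v t) x (EuclideanSpace.single i 1) 2 := by
    intro i
    have hθd : DifferentiableAt ℝ (fun y => v t y 2) x := (hθx.differentiable (by simp)) x
    have h := ((hmt.differentiable (by norm_num)) (v t x 2)).hasDerivAt.comp_hasFDerivAt x hθd.hasFDerivAt
    rw [hMfun t, show (fun y => m t (v t y 2)) = m t ∘ fun y => v t y 2 from rfl, h.fderiv]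
    simp only [FunLike.coe_smul, Pi.smul_apply, smul_eq_mul]
    rw [FluidPDE.fderiv_apply_coord (hsd x)]
  -- ## assemble: the law for `∂₂v_b`, rewritten through `M g`
  have hL3' : M t x * (deriv (fun s => g s x) t + fderiv ℝ (g t) x (v t x) - Δ (g t) x)
      + g t x * (deriv (fun s => M s x) t + fderiv ℝ (M t) x (v t x) - Δ (M t) x)
      - 2 * ∑ i : Fin 3, fderiv ℝ (M t) x (EuclideanSpace.single i 1) * fderiv ℝ (g t) x (EuclideanSpace.single i 1) =
      fderiv ℝ (fun y => timeDerivWithin (Iio 0) v t y + convect (v t) (v t) y - Δ (v t) y) x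
          (EuclideanSpace.single 2 1) b -
        ∑ j : Fin 3, fderiv ℝ (v t) x (EuclideanSpace.single 2 1) j *
          fderiv ℝ (v t) x (EuclideanSpace.single j 1) b := by
    rw [← hLeib, ← hL3, hfun_t.deriv_eq, hfun_x]
  -- `𝓛g` from the law for `∂_b v₂`
  have hLg : deriv (fun s => g s x) t + fderiv ℝ (g t) x (v t x) - Δ (g t) x =
      fderiv ℝ (fun y => timeDerivWithin (Iio 0) v t y + convect (v t) (v t) y - Δ (v t) y) x
          (EuclideanSpace.single b 1) 2 -
        ∑ j : Fin 3, fderiv ℝ (v t) x (EuclideanSpace.single b 1) j *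
          fderiv ℝ (v t) x (EuclideanSpace.single j 1) 2 := by
    have e1 : (fun s => g s x) = fun s => fderiv ℝ (v s) x (EuclideanSpace.single b 1) 2 := funext fun s => hg s x
    rw [e1, hgfun t, ← hLb]
  rw [hLg, hLM] at hL3'
  simp only [hdM] at hL3'
  have hgtx : g t x = fderiv ℝ (v t) x (EuclideanSpace.single b 1) 2 := hg t x
  rw [hgtx, hgfun t] at hL3'
  -- ## pointwise inputs: the slope at `(t,x)` and `∂₀v₁ = ∂₁v₀`
  have h20 : fderiv ℝ (v t) x (EuclideanSpace.single 2 1) 0 =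
      m t (v t x 2) * fderiv ℝ (v t) x (EuclideanSpace.single 0 1) 2 := hslope t ht x 0 (by decide)
  have h21 : fderiv ℝ (v t) x (EuclideanSpace.single 2 1) 1 =
      m t (v t x 2) * fderiv ℝ (v t) x (EuclideanSpace.single 1 1) 2 := hslope t ht x 1 (by decide)
  have hω2 : curl (v t) x 2 = 0 := by simpa [EuclideanSpace.inner_single_right] using hpol t ht x
  have hsym : fderiv ℝ (v t) x (EuclideanSpace.single 0 1) 1 = fderiv ℝ (v t) x (EuclideanSpace.single 1 1) 0 := by
    have h : fderiv ℝ (v t) x (EuclideanSpace.single 0 1) 1 - fderiv ℝ (v t) x (EuclideanSpace.single 1 1) 0 = 0 := by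
      simpa [curl] using hω2
    linarith
  have hMtx : M t x = m t (v t x 2) := hM t x
  rw [hMtx] at hL3'
  -- ## name the atoms and finish by linear algebra
  obtain ⟨D, hD⟩ : ∃ D : EuclideanSpace ℝ (Fin 3) →L[ℝ] EuclideanSpace ℝ (Fin 3), fderiv ℝ (v t) x = D := ⟨_, rfl⟩
  obtain ⟨G', hG'⟩ : ∃ G' : EuclideanSpace ℝ (Fin 3) →L[ℝ] EuclideanSpace ℝ (Fin 3),
      fderiv ℝ (fun y => timeDerivWithin (Iio 0) v t y + convect (v t) (v t) y - Δ (v t) y) x = G' := ⟨_, rfl⟩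
  generalize hF2 : (timeDerivWithin (Iio 0) v t x + convect (v t) (v t) x - Δ (v t) x) 2 = F₂ at hL3' ⊢
  generalize hM0 : m t (v t x 2) = M₀ at hL3' h20 h21 ⊢
  generalize hM1 : deriv (m t) (v t x 2) = M₁ at hL3' ⊢
  generalize hM2 : deriv (deriv (m t)) (v t x 2) = M₂ at hL3' ⊢
  generalize hMt' : deriv (fun τ => m τ (v t x 2)) t = Mt at hL3' ⊢
  generalize hS : (fun i : Fin 3 => fderiv ℝ (fun y => fderiv ℝ (v t) y (EuclideanSpace.single b 1) 2) x
      (EuclideanSpace.single i 1)) = S at hL3' ⊢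
  have hS' : ∀ i : Fin 3, fderiv ℝ (fun y => fderiv ℝ (v t) y (EuclideanSpace.single b 1) 2) x
      (EuclideanSpace.single i 1) = S i := fun i => by rw [← hS]
  simp only [hS'] at hL3' ⊢
  rw [hD] at hL3' h20 h21 hsym ⊢
  rw [hG'] at hL3' hc0 hc1 ⊢
  rcases hb' with rfl | rfl
  · simp only [Fin.sum_univ_three, Fin.isValue] at hL3' ⊢
    linear_combination (-1 : ℝ) * hL3' + hc0 + (D (EuclideanSpace.single 0 1) 0 + D (EuclideanSpace.single 2 1) 2) * h20
      + D (EuclideanSpace.single 1 1) 0 * h21 - M₀ * D (EuclideanSpace.single 1 1) 2 * hsym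
  · simp only [Fin.sum_univ_three, Fin.isValue] at hL3' ⊢
    linear_combination (-1 : ℝ) * hL3' + hc1 + D (EuclideanSpace.single 0 1) 1 * h20
      + (D (EuclideanSpace.single 1 1) 1 + D (EuclideanSpace.single 2 1) 2) * h21
      + M₀ * D (EuclideanSpace.single 0 1) 2 * hsym

/-! ### The Clebsch weight `u = v₂ − G(t,v₂)` of the stratum (SF) -/

/-- **Material derivative of the Clebsch weight.**  For a profile of the class and ANY jointly `C²` function
`G : ℝ → ℝ → ℝ`, at `t < 0`, `x`, with `θ₀ = v₂(t,x)` and `f₂` the vertical component of the intrinsic residual: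
`𝓛[v₂ − G(·,v₂)] = (1 − ∂_sG(t,θ₀))·f₂ − ∂ₜG(t,θ₀) + ∂_s²G(t,θ₀)·Σᵢ(∂ᵢv₂)²`. -/
theorem material_clebschWeight {G : ℝ → ℝ → ℝ} (hG : ContDiff ℝ 2 (uncurry G)) {t : ℝ} (ht : t < 0)
    (x : EuclideanSpace ℝ (Fin 3)) :
    deriv (fun s => v s x 2 - G s (v s x 2)) t + fderiv ℝ (fun y => v t y 2 - G t (v t y 2)) x (v t x)
        - Δ (fun y => v t y 2 - G t (v t y 2)) x =
      (1 - deriv (G t) (v t x 2)) * (timeDerivWithin (Iio 0) v t x + convect (v t) (v t) x - Δ (v t) x) 2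
        - deriv (fun τ => G τ (v t x 2)) t
        + deriv (deriv (G t)) (v t x 2) * ∑ i : Fin 3, fderiv ℝ (v t) x (EuclideanSpace.single i 1) 2 ^ 2 := by
  have hA : IsTypeIAncientMild C v := isTypeIAncientMild_of_class hrate hcont hmild hdiv
  have hsd : Differentiable ℝ (v t) := (hA.contDiff_slice ht).differentiable (by simp)
  have hθx : ContDiff ℝ 2 (fun y => v t y 2) := (contDiff_vert_slice hrate hcont hmild hdiv ht).of_le (by norm_cast)
  have hθt : DifferentiableAt ℝ (fun s => v s x 2) t := differentiableAt_vert_time hrate hcont hmild hdiv ht x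
  have hGt : ContDiff ℝ 2 (G t) := hG.comp (contDiff_const.prodMk contDiff_id)
  have hHx : ContDiff ℝ 2 (fun y => G t (v t y 2)) := hGt.comp hθx
  have hHt : DifferentiableAt ℝ (fun s => G s (v s x 2)) t :=
    ((hG.differentiable (by norm_num)) _).comp t (differentiableAt_id.prodMk hθt)
  have hsub := material_sub (θ₁ := fun s y => v s y 2) (θ₂ := fun s y => G s (v s y 2)) (t := t) (x := x)
    (v t x) hθt hHt hθx hHx
  beta_reduce at hsub
  rw [hsub, material_regauge (θ := fun s y => v s y 2) (G := G) (v t x) hG hθt hθx,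
    material_vert_eq_residual hrate hcont hmild hdiv ht x]
  have e2 : ∀ i : Fin 3, fderiv ℝ (fun y => v t y 2) x (EuclideanSpace.single i 1) =
      fderiv ℝ (v t) x (EuclideanSpace.single i 1) 2 := fun i => FluidPDE.fderiv_apply_coord (hsd x) _ 2
  simp only [e2]
  ring

/-- **The gradient of the Clebsch weight** is `(1 − ∂_sG(t,v₂))·∇v₂` (chain rule), as a Fréchet derivative. -/
theorem hasFDerivAt_clebschWeight {G : ℝ → ℝ → ℝ} (hG : ContDiff ℝ 2 (uncurry G)) {t : ℝ} (ht : t < 0)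
    (y : EuclideanSpace ℝ (Fin 3)) :
    HasFDerivAt (fun z => v t z 2 - G t (v t z 2))
      ((1 - deriv (G t) (v t y 2)) • fderiv ℝ (fun z => v t z 2) y) y := by
  have hθd : DifferentiableAt ℝ (fun z => v t z 2) y :=
    ((contDiff_vert_slice hrate hcont hmild hdiv ht).differentiable (by simp)) y
  have hGt : ContDiff ℝ 2 (G t) := hG.comp (contDiff_const.prodMk contDiff_id)
  have h1 := ((hGt.differentiable (by norm_num)) (v t y 2)).hasDerivAt.comp_hasFDerivAt y hθd.hasFDerivAt
  have h2 := hθd.hasFDerivAt.sub h1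
  have e : fderiv ℝ (fun z => v t z 2) y - deriv (G t) (v t y 2) • fderiv ℝ (fun z => v t z 2) y =
      (1 - deriv (G t) (v t y 2)) • fderiv ℝ (fun z => v t z 2) y := by
    rw [sub_smul, one_smul]
  rw [← e]
  exact h2

omit hrate hcont hmild hdiv in
/-- **On (SF) the horizontal vorticity is the rotated gradient of the Clebsch weight**: with `∂₂v_b = ∂_sG(t,v₂)∂_bv₂`,
`ω₀ = (1 − ∂_sG)∂₁v₂`, `ω₁ = −(1 − ∂_sG)∂₀v₂`, and `ω₂ = 0` (poloidality). -/
theorem curl_eq_of_slopeFunction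
    (hpol : ∀ s < 0, ∀ y, ⟪curl (v s) y, EuclideanSpace.single 2 1⟫_ℝ = 0) {G : ℝ → ℝ → ℝ} {t : ℝ} (ht : t < 0)
    (hslope : ∀ s < 0, ∀ y, ∀ b : Fin 3, b ≠ 2 →
      fderiv ℝ (v s) y (EuclideanSpace.single 2 1) b =
        deriv (G s) (v s y 2) * fderiv ℝ (v s) y (EuclideanSpace.single b 1) 2)
    (y : EuclideanSpace ℝ (Fin 3)) :
    curl (v t) y 0 = (1 - deriv (G t) (v t y 2)) * fderiv ℝ (v t) y (EuclideanSpace.single 1 1) 2 ∧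
      curl (v t) y 1 = -((1 - deriv (G t) (v t y 2)) * fderiv ℝ (v t) y (EuclideanSpace.single 0 1) 2) ∧
      curl (v t) y 2 = 0 := by
  have h20 := hslope t ht y 0 (by decide)
  have h21 := hslope t ht y 1 (by decide)
  have hω2 : curl (v t) y 2 = 0 := by simpa [EuclideanSpace.inner_single_right] using hpol t ht y
  refine ⟨?_, ?_, hω2⟩
  · have e : curl (v t) y 0 = fderiv ℝ (v t) y (EuclideanSpace.single 1 1) 2 -
        fderiv ℝ (v t) y (EuclideanSpace.single 2 1) 1 := by simp [curl]
    rw [e, h21]; ring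
  · have e : curl (v t) y 1 = fderiv ℝ (v t) y (EuclideanSpace.single 2 1) 0 -
        fderiv ℝ (v t) y (EuclideanSpace.single 0 1) 2 := by simp [curl]
    rw [e, h20]; ring

end Class

end Summit.NavierStokesRegularity.NavierStokesRegularity.Theorems.PoloidalWindowDoorPoloidalWindowRigiditySlopeFunctionPressure

end
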